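import Mathlib
import HarnessLib
import Summits.HubbardSuperconductivity.HubbardSuperconductivity.Theorems.KLProgrammeSalmhoferCutoffThirdDerivBound

/-!
# Route `KLProgramme` — engine support: monotone ENCLOSURE machinery for a sharp bound on `smoothTransition″` (part 1 of 2)

Cell gate-hubbard-kl, seat hubbard-kl-k3c3-p3 (g6).  The far («cutoff-shell») sizes `S_k` of stub (C)'s (C1) door are polynomials in the numerals
`sup|χ₂^{(l)}|`, `l ≤ k`; the tree's `|χ₂″| < 1110` (`…SalmhoferCutoffSecondDerivBound`, `84e²` for `smoothTransition″`) is ≈ 63× the truth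
(`sup|smoothTransition″| ≈ 9.84`, `sup|χ₂″| ≈ 17.5` [float]), which alone sinks the crude certification of the `(k = 2, n = 2)` entry at `P = 7`
(KL STATUS 2026-08-27 l.3010, memo JACKSON-FLAT §5).  This file and its sequel `…SalmhoferCutoffSecondDerivSharp` certify **`|smoothTransition″| ≤ 11`** on `ℝ` by a monotone interval
enclosure of the logistic form `σ″ = E/(1+E)²·[((E−1)/(E+1))·(u²+w²)² − (2u³ − 2w³)]` (`u = x⁻¹`, `w = (1−x)⁻¹`, `E = e^{u−w}`; `kltd_deriv2_eq`) on 37 sub-intervals of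
`[1/8, 1/2]`, an exponential-decay bound on `(0, 1/8]`, the reflection `x ↦ 1 − x`, and continuity at the end points; the only transcendental input is
`e^{1/8} ∈ [145/128, 4533/4000]` (`Real.quadratic_le_exp_of_nonneg`, `Real.exp_bound'`).  THIS PART: §1 the `e^{1/8}` brackets and the induced
bounds `klsh_exp_lower/upper`; §2 the regrouping `klsh_regroup`, the abstract enclosure `klsh_enclose` and the **piece lemma `klsh_piece`** (all factors
monotone in `x`); §3 the end-point piece `klsh_abs_deriv2_le_of_le_eighth` (`|σ″| ≤ 5` on `(0, 1/8]`); §4 the reflection `klsh_deriv2_one_sub`.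
Pure real analysis; nothing about the model. [folklore]
-/

noncomputable section

namespace Summit.HubbardSuperconductivity.HubbardSuperconductivity.Theorems.KLRegimeSplit

set_option linter.dupNamespace false -- summit = problem name (single-conjunct summit), D-0017

open Real Set Filter Literature.MathematicalPhysics.QuantumLattice
open scoped Topology

/-! ## §1 Rational brackets for `e^{1/8}` and the induced bounds on `e^t` -/

/-- `145/128 ≤ e^{1/8}` (`1 + y + y²/2 ≤ eʸ`). -/
theorem klsh_exp_eighth_ge : (145 / 128 : ℝ) ≤ Real.exp (1 / 8) := by
  have h := Real.quadratic_le_exp_of_nonneg (show (0 : ℝ) ≤ 1 / 8 by norm_num)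
  norm_num at h; exact h

/-- `e^{1/8} ≤ 4533/4000` (Taylor with remainder, three terms). -/
theorem klsh_exp_eighth_le : Real.exp (1 / 8) ≤ (4533 / 4000 : ℝ) := by
  have h := Real.exp_bound' (show (0 : ℝ) ≤ 1 / 8 by norm_num) (show (1 / 8 : ℝ) ≤ 1 by norm_num) (show 0 < 3 by norm_num)
  rw [show (3 : ℕ) = 1 + 1 + 1 from rfl] at h
  simp only [Finset.sum_range_succ, Finset.sum_range_zero, Nat.factorial] at h
  norm_num at h
  linarith

/-- **Lower bracket**: `(145/128)^m·(1 + (t − m/8)) ≤ eᵗ` for `m/8 ≤ t`. -/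
theorem klsh_exp_lower (m : ℕ) {t : ℝ} (hmt : (m : ℝ) / 8 ≤ t) : (145 / 128 : ℝ) ^ m * (1 + (t - m / 8)) ≤ Real.exp t := by
  have h1 : (145 / 128 : ℝ) ^ m ≤ Real.exp ((m : ℝ) / 8) := by
    rw [show (m : ℝ) / 8 = m * (1 / 8) by ring, Real.exp_nat_mul]
    exact pow_le_pow_left₀ (by norm_num) klsh_exp_eighth_ge m
  have h2 : 1 + (t - m / 8) ≤ Real.exp (t - m / 8) := by linarith [Real.add_one_le_exp (t - m / 8)]
  calc (145 / 128 : ℝ) ^ m * (1 + (t - m / 8)) ≤ Real.exp ((m : ℝ) / 8) * Real.exp (t - m / 8) :=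
        mul_le_mul h1 h2 (by linarith) (Real.exp_pos _).le
    _ = Real.exp t := by rw [← Real.exp_add]; ring_nf

/-- **Upper bracket**: `eᵗ ≤ (4533/4000)^m` for `t ≤ m/8`. -/
theorem klsh_exp_upper (m : ℕ) {t : ℝ} (htm : t ≤ (m : ℝ) / 8) : Real.exp t ≤ (4533 / 4000 : ℝ) ^ m := by
  calc Real.exp t ≤ Real.exp ((m : ℝ) / 8) := Real.exp_le_exp.2 htm
    _ = Real.exp (1 / 8) ^ m := by rw [show (m : ℝ) / 8 = m * (1 / 8) by ring, Real.exp_nat_mul]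
    _ ≤ (4533 / 4000 : ℝ) ^ m := pow_le_pow_left₀ (Real.exp_pos _).le klsh_exp_eighth_le m

/-! ## §2 The monotone enclosure on one piece `[a, b] ⊂ (0, 1/2]` -/

/-- The logistic expression of `kltd_deriv2_eq`, regrouped: `s(1−s)[(1−2s)h² + h′] = E/(1+E)²·[((E−1)/(E+1))h² − B]`. -/
theorem klsh_regroup (E h2 B : ℝ) (hE : 0 < E) :
    (1 + E)⁻¹ * (1 - (1 + E)⁻¹) * ((1 - 2 * (1 + E)⁻¹) * h2 + -B) = E / (1 + E) ^ 2 * ((E - 1) / (E + 1) * h2 - B) := by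
  have h1 : (1 + E) ≠ 0 := by positivity
  have h2' : (E + 1) ≠ 0 := by positivity
  field_simp
  ring

/-- **Abstract enclosure**: if `0 ≤ ω ≤ Ω`, `f_L ≤ f ≤ f_U` with `0 ≤ f`, `0 ≤ h_L ≤ h ≤ h_U`, `B_L ≤ B ≤ B_U`, then
`|ω·(f·h − B)| ≤ C` as soon as `Ω·(f_U h_U − B_L) ≤ C` and `Ω·(B_U − f_L h_L) ≤ C` (`0 ≤ C`). -/
theorem klsh_enclose {ω Ω f fL fU h hL hU B BL BU C : ℝ} (hω0 : 0 ≤ ω) (hωΩ : ω ≤ Ω) (hf0 : 0 ≤ f)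
    (hfL : fL ≤ f) (hfU : f ≤ fU) (hh0 : 0 ≤ hL) (hhL : hL ≤ h) (hhU : h ≤ hU) (hBL : BL ≤ B) (hBU : B ≤ BU) (hC : 0 ≤ C)
    (hup : Ω * (fU * hU - BL) ≤ C) (hlow : Ω * (BU - fL * hL) ≤ C) : |ω * (f * h - B)| ≤ C := by
  have hh : 0 ≤ h := hh0.trans hhL
  have hXle : f * h - B ≤ fU * hU - BL := by
    have := mul_le_mul hfU hhU hh (hf0.trans hfU); linarith
  have hYle : fL * hL - BU ≤ f * h - B := by
    have := mul_le_mul hfL hhL hh0 hf0; linarith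
  rw [abs_le]
  constructor
  · -- lower
    have h1 : ω * (fL * hL - BU) ≤ ω * (f * h - B) := mul_le_mul_of_nonneg_left hYle hω0
    rcases le_or_gt 0 (fL * hL - BU) with hY0 | hY0
    · have : 0 ≤ ω * (fL * hL - BU) := mul_nonneg hω0 hY0
      linarith
    · have h2 : Ω * (fL * hL - BU) ≤ ω * (fL * hL - BU) := by
        have := mul_le_mul_of_nonneg_left hωΩ (by linarith : 0 ≤ -(fL * hL - BU)); linarith
      linarith
  · -- upper
    have h1 : ω * (f * h - B) ≤ ω * (fU * hU - BL) := mul_le_mul_of_nonneg_left hXle hω0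
    rcases le_or_gt 0 (fU * hU - BL) with hX0 | hX0
    · have h2 : ω * (fU * hU - BL) ≤ Ω * (fU * hU - BL) := mul_le_mul_of_nonneg_right hωΩ hX0
      linarith
    · have : ω * (fU * hU - BL) ≤ 0 := mul_nonpos_iff.2 (Or.inl ⟨hω0, hX0.le⟩)
      linarith

/-- **Piece lemma.**  On `a ≤ x ≤ b` (`0 < a`, `b ≤ 1/2`), with rational brackets `1 ≤ L ≤ e^{t(b)}`, `e^{t(a)} ≤ U` (`t(y) = y⁻¹ − (1−y)⁻¹`):
`|σ″(x)| ≤ C` as soon as `Ω·(f_U·H² − B_b) ≤ C` and `Ω·(B_a − f_L·h_b²) ≤ C`, where `Ω = L/(1+L)²`, `f_V = (V−1)/(V+1)`, `H = a⁻² + (1−b)⁻²`,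
`h_b = b⁻² + (1−a)⁻²`, `B_y = 2y⁻³ − 2(1−y)⁻³` (every factor is monotone in `x`). -/
theorem klsh_piece {a b L U C x : ℝ} (ha : 0 < a) (hax : a ≤ x) (hxb : x ≤ b) (hb : b ≤ 1 / 2) (hL1 : 1 ≤ L)
    (hL : L ≤ Real.exp (b⁻¹ - (1 - b)⁻¹)) (hU : Real.exp (a⁻¹ - (1 - a)⁻¹) ≤ U) (hC : 0 ≤ C)
    (hup : L / (1 + L) ^ 2 * ((U - 1) / (U + 1) * ((a⁻¹) ^ 2 + ((1 - b)⁻¹) ^ 2) ^ 2 - (2 * (b⁻¹) ^ 3 - 2 * ((1 - b)⁻¹) ^ 3)) ≤ C)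
    (hlow : L / (1 + L) ^ 2 * ((2 * (a⁻¹) ^ 3 - 2 * ((1 - a)⁻¹) ^ 3) - (L - 1) / (L + 1) * ((b⁻¹) ^ 2 + ((1 - a)⁻¹) ^ 2) ^ 2) ≤ C) :
    |deriv (deriv Real.smoothTransition) x| ≤ C := by
  have h0 : 0 < x := lt_of_lt_of_le ha hax
  have h1 : x < 1 := by linarith
  have h1x : 0 < 1 - x := by linarith
  have h1a : 0 < 1 - a := by linarith
  have h1b : 0 < 1 - b := by linarith
  have hb0' : 0 < b := lt_of_lt_of_le h0 hxb
  rw [kltd_deriv2_eq h0 h1]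
  have hEpos : 0 < Real.exp (x⁻¹ - (1 - x)⁻¹) := Real.exp_pos _
  -- monotone brackets of `u = x⁻¹`, `w = (1−x)⁻¹`
  have hu_hi : x⁻¹ ≤ a⁻¹ := (inv_le_inv₀ h0 ha).2 hax
  have hu_lo : b⁻¹ ≤ x⁻¹ := (inv_le_inv₀ hb0' h0).2 hxb
  have hw_hi : (1 - x)⁻¹ ≤ (1 - b)⁻¹ := (inv_le_inv₀ h1x h1b).2 (by linarith)
  have hw_lo : (1 - a)⁻¹ ≤ (1 - x)⁻¹ := (inv_le_inv₀ h1a h1x).2 (by linarith)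
  have hu0 : 0 ≤ x⁻¹ := inv_nonneg.2 h0.le
  have hw0 : 0 ≤ (1 - x)⁻¹ := inv_nonneg.2 h1x.le
  have hb0 : 0 ≤ b⁻¹ := inv_nonneg.2 hb0'.le
  have ha0' : 0 ≤ (1 - a)⁻¹ := inv_nonneg.2 h1a.le
  -- brackets of `E`
  have hEL : L ≤ Real.exp (x⁻¹ - (1 - x)⁻¹) := hL.trans (Real.exp_le_exp.2 (by linarith))
  have hEU : Real.exp (x⁻¹ - (1 - x)⁻¹) ≤ U := (Real.exp_le_exp.2 (by linarith)).trans hU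
  generalize Real.exp (x⁻¹ - (1 - x)⁻¹) = E at hEpos hEL hEU ⊢
  have hE1 : 1 ≤ E := hL1.trans hEL
  -- the weight and the odd factor
  have hΩ : E / (1 + E) ^ 2 ≤ L / (1 + L) ^ 2 := by
    rw [div_le_div_iff₀ (by positivity) (by positivity)]
    have : 0 ≤ (E - L) * (E * L - 1) := mul_nonneg (by linarith) (by nlinarith)
    nlinarith
  have hω0 : 0 ≤ E / (1 + E) ^ 2 := by positivity
  have hf_hi : (E - 1) / (E + 1) ≤ (U - 1) / (U + 1) := by
    rw [div_le_div_iff₀ (by positivity) (by linarith)]; nlinarith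
  have hf_lo : (L - 1) / (L + 1) ≤ (E - 1) / (E + 1) := by
    rw [div_le_div_iff₀ (by positivity) (by positivity)]; nlinarith
  have hf0 : 0 ≤ (E - 1) / (E + 1) := div_nonneg (by linarith) (by positivity)
  -- brackets of `h² = (u² + w²)²` and `B = 2u³ − 2w³`
  have hh_hi : (x⁻¹) ^ 2 + ((1 - x)⁻¹) ^ 2 ≤ (a⁻¹) ^ 2 + ((1 - b)⁻¹) ^ 2 :=
    add_le_add (pow_le_pow_left₀ hu0 hu_hi 2) (pow_le_pow_left₀ hw0 hw_hi 2)
  have hh_lo : (b⁻¹) ^ 2 + ((1 - a)⁻¹) ^ 2 ≤ (x⁻¹) ^ 2 + ((1 - x)⁻¹) ^ 2 :=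
    add_le_add (pow_le_pow_left₀ hb0 hu_lo 2) (pow_le_pow_left₀ ha0' hw_lo 2)
  have hh0 : 0 ≤ (b⁻¹) ^ 2 + ((1 - a)⁻¹) ^ 2 := by positivity
  have hh2_hi : ((x⁻¹) ^ 2 + ((1 - x)⁻¹) ^ 2) ^ 2 ≤ ((a⁻¹) ^ 2 + ((1 - b)⁻¹) ^ 2) ^ 2 :=
    pow_le_pow_left₀ (hh0.trans hh_lo) hh_hi 2
  have hh2_lo : ((b⁻¹) ^ 2 + ((1 - a)⁻¹) ^ 2) ^ 2 ≤ ((x⁻¹) ^ 2 + ((1 - x)⁻¹) ^ 2) ^ 2 := pow_le_pow_left₀ hh0 hh_lo 2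
  have hB_lo : 2 * (b⁻¹) ^ 3 - 2 * ((1 - b)⁻¹) ^ 3 ≤ 2 * (x⁻¹) ^ 3 - 2 * ((1 - x)⁻¹) ^ 3 := by
    have := pow_le_pow_left₀ hb0 hu_lo 3; have := pow_le_pow_left₀ hw0 hw_hi 3; linarith
  have hB_hi : 2 * (x⁻¹) ^ 3 - 2 * ((1 - x)⁻¹) ^ 3 ≤ 2 * (a⁻¹) ^ 3 - 2 * ((1 - a)⁻¹) ^ 3 := by
    have := pow_le_pow_left₀ hu0 hu_hi 3; have := pow_le_pow_left₀ ha0' hw_lo 3; linarith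
  -- regroup and enclose
  rw [show -2 * (x⁻¹) ^ 3 + 2 * ((1 - x)⁻¹) ^ 3 = -(2 * (x⁻¹) ^ 3 - 2 * ((1 - x)⁻¹) ^ 3) by ring, klsh_regroup E _ _ hEpos]
  exact klsh_enclose hω0 hΩ hf0 hf_lo hf_hi (by positivity) hh2_lo hh2_hi hB_lo hB_hi hC hup hlow

/-- **Piece lemma, packaged**: the brackets `L ≤ e^{t(b)}`, `e^{t(a)} ≤ U` discharged through `klsh_exp_lower m` / `klsh_exp_upper m'`, so that every
remaining hypothesis is a closed rational inequality (`norm_num`). -/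
theorem klsh_piece' {a b L U C x : ℝ} (m m' : ℕ) (hax : a ≤ x) (hxb : x ≤ b) (ha : 0 < a) (hb : b ≤ 1 / 2) (hL1 : 1 ≤ L)
    (hm : (m : ℝ) / 8 ≤ b⁻¹ - (1 - b)⁻¹) (hLle : L ≤ (145 / 128 : ℝ) ^ m * (1 + (b⁻¹ - (1 - b)⁻¹ - m / 8)))
    (hm' : a⁻¹ - (1 - a)⁻¹ ≤ (m' : ℝ) / 8) (hUge : (4533 / 4000 : ℝ) ^ m' ≤ U) (hC : 0 ≤ C)
    (hup : L / (1 + L) ^ 2 * ((U - 1) / (U + 1) * ((a⁻¹) ^ 2 + ((1 - b)⁻¹) ^ 2) ^ 2 - (2 * (b⁻¹) ^ 3 - 2 * ((1 - b)⁻¹) ^ 3)) ≤ C)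
    (hlow : L / (1 + L) ^ 2 * ((2 * (a⁻¹) ^ 3 - 2 * ((1 - a)⁻¹) ^ 3) - (L - 1) / (L + 1) * ((b⁻¹) ^ 2 + ((1 - a)⁻¹) ^ 2) ^ 2) ≤ C) :
    |deriv (deriv Real.smoothTransition) x| ≤ C :=
  klsh_piece ha hax hxb hb hL1 (hLle.trans (klsh_exp_lower m hm)) ((klsh_exp_upper m' hm').trans hUge) hC hup hlow

/-! ## §3 Near the end point: `0 < x ≤ 1/8` -/

/-- `u⁴e^{−u} ≤ 4096·e^{−8}` for `u ≥ 8` (from `y ≤ e^{y−1}` at `y = u/8`, eighth power). -/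
theorem klsh_pow_four_mul_exp_neg_le {u : ℝ} (hu : 8 ≤ u) : u ^ 4 * Real.exp (-u) ≤ 4096 * Real.exp (-8) := by
  have hu0 : 0 < u := by linarith
  have hy : u / 8 ≤ Real.exp (u / 8 - 1) := by linarith [Real.add_one_le_exp (u / 8 - 1)]
  have hpow : (u / 8) ^ 8 ≤ Real.exp (u - 8) := by
    have h := pow_le_pow_left₀ (by positivity) hy 8
    rwa [← Real.exp_nat_mul, show ((8 : ℕ) : ℝ) * (u / 8 - 1) = u - 8 by push_cast; ring] at h
  have hA : u ^ 8 * Real.exp (-u) ≤ 8 ^ 8 * Real.exp (-8) := by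
    have h := mul_le_mul_of_nonneg_right hpow (Real.exp_pos (-u)).le
    rw [← Real.exp_add, show u - 8 + -u = -8 by ring] at h
    have e : u ^ 8 * Real.exp (-u) = 8 ^ 8 * ((u / 8) ^ 8 * Real.exp (-u)) := by ring
    rw [e]; exact mul_le_mul_of_nonneg_left h (by norm_num)
  have hu4 : (4096 : ℝ) ≤ u ^ 4 := by
    have h := pow_le_pow_left₀ (by norm_num) hu 4
    norm_num at h; exact h
  have he0 : 0 < Real.exp (-u) := Real.exp_pos _
  -- `u⁴e^{−u}·4096 ≤ u⁴e^{−u}·u⁴ = u⁸e^{−u} ≤ 8⁸e^{−8} = 4096·(4096 e^{−8})`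
  have h1 : u ^ 4 * Real.exp (-u) * 4096 ≤ u ^ 4 * Real.exp (-u) * u ^ 4 :=
    mul_le_mul_of_nonneg_left hu4 (by positivity)
  have h2 : u ^ 4 * Real.exp (-u) * u ^ 4 = u ^ 8 * Real.exp (-u) := by ring
  nlinarith

/-- `900 ≤ e^{48/7}`. -/
theorem klsh_exp_48_div_7_ge : (900 : ℝ) ≤ Real.exp (48 / 7) :=
  le_trans (by norm_num) (klsh_exp_lower 54 (by norm_num : ((54 : ℕ) : ℝ) / 8 ≤ (48 / 7 : ℝ)))

/-- **`|smoothTransition″| ≤ 5` on `(0, 1/8]`**: there `|σ″| ≤ e^{w−u}(u²+w²)² ≤ e^{8/7}(50/49)²·u⁴e^{−u} ≤ (50/49)²·4096·e^{−48/7}`. -/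
theorem klsh_abs_deriv2_le_of_le_eighth {x : ℝ} (h0 : 0 < x) (h8 : x ≤ 1 / 8) : |deriv (deriv Real.smoothTransition) x| ≤ 5 := by
  have h1 : x < 1 := by linarith
  have h1x : 0 < 1 - x := by linarith
  rw [kltd_deriv2_eq h0 h1]
  set E := Real.exp (x⁻¹ - (1 - x)⁻¹) with hE
  set u := x⁻¹ with hu
  set w := (1 - x)⁻¹ with hw
  have hEpos : 0 < E := Real.exp_pos _
  have hu8 : 8 ≤ u := by
    rw [hu, ← one_div, le_div_iff₀ h0]; linarith
  have hw1 : 1 ≤ w := by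
    rw [hw, ← one_div, le_div_iff₀ h1x]; linarith
  have hw87 : w ≤ 8 / 7 := by
    rw [hw, ← one_div, div_le_iff₀ h1x]; linarith
  have hu0 : 0 < u := by linarith
  have hE1 : 1 ≤ E := Real.one_le_exp (by linarith)
  rw [show -2 * u ^ 3 + 2 * w ^ 3 = -(2 * u ^ 3 - 2 * w ^ 3) by ring, klsh_regroup E _ _ hEpos]
  -- sizes
  have hω0 : 0 ≤ E / (1 + E) ^ 2 := by positivity
  have hωE : E / (1 + E) ^ 2 ≤ E⁻¹ := by
    rw [div_le_iff₀ (by positivity), ← div_eq_inv_mul, le_div_iff₀ hEpos]; nlinarith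
  have hf0 : 0 ≤ (E - 1) / (E + 1) := div_nonneg (by linarith) (by positivity)
  have hf1 : (E - 1) / (E + 1) ≤ 1 := by rw [div_le_one (by positivity)]; linarith
  have hh0 : 0 ≤ (u ^ 2 + w ^ 2) ^ 2 := by positivity
  have hw2 : w ^ 2 ≤ u ^ 2 / 49 := by nlinarith
  have hh : (u ^ 2 + w ^ 2) ^ 2 ≤ (50 / 49) ^ 2 * u ^ 4 := by nlinarith
  have hB0 : 0 ≤ 2 * u ^ 3 - 2 * w ^ 3 := by nlinarith
  have hBh : 2 * u ^ 3 - 2 * w ^ 3 ≤ (u ^ 2 + w ^ 2) ^ 2 := by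
    have hu3 : 0 < u ^ 3 := pow_pos hu0 3
    have h8 : 8 * u ^ 3 ≤ u ^ 4 := by
      have := mul_le_mul_of_nonneg_right hu8 hu3.le
      calc 8 * u ^ 3 ≤ u * u ^ 3 := this
        _ = u ^ 4 := by ring
    have hsq : u ^ 4 ≤ (u ^ 2 + w ^ 2) ^ 2 := by nlinarith [sq_nonneg w, mul_nonneg (sq_nonneg u) (sq_nonneg w)]
    have hw3 : 0 ≤ w ^ 3 := by positivity
    linarith
  -- `|ω(f h² − B)| ≤ ω h²`
  have habs : |E / (1 + E) ^ 2 * ((E - 1) / (E + 1) * (u ^ 2 + w ^ 2) ^ 2 - (2 * u ^ 3 - 2 * w ^ 3))| ≤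
      E / (1 + E) ^ 2 * (u ^ 2 + w ^ 2) ^ 2 := by
    rw [abs_mul, abs_of_nonneg hω0]
    refine mul_le_mul_of_nonneg_left (abs_le.2 ⟨?_, ?_⟩) hω0
    · nlinarith [mul_nonneg hf0 hh0]
    · nlinarith [mul_le_mul_of_nonneg_right hf1 hh0]
  -- `E⁻¹ = e^{w−u} ≤ e^{8/7}·e^{−u}`
  have hEinv : E⁻¹ ≤ Real.exp (8 / 7) * Real.exp (-u) := by
    rw [hE, ← Real.exp_neg, ← Real.exp_add]
    exact Real.exp_le_exp.2 (by linarith)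
  have hdec := klsh_pow_four_mul_exp_neg_le hu8
  have h900 := klsh_exp_48_div_7_ge
  have hexp : Real.exp (8 / 7) * Real.exp (-8) * 900 ≤ 1 := by
    rw [← Real.exp_add, show (8 / 7 : ℝ) + -8 = -(48 / 7) by norm_num, Real.exp_neg]
    rw [inv_mul_le_iff₀ (Real.exp_pos _)]; linarith
  calc |E / (1 + E) ^ 2 * ((E - 1) / (E + 1) * (u ^ 2 + w ^ 2) ^ 2 - (2 * u ^ 3 - 2 * w ^ 3))|
      ≤ E / (1 + E) ^ 2 * (u ^ 2 + w ^ 2) ^ 2 := habs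
    _ ≤ E⁻¹ * ((50 / 49) ^ 2 * u ^ 4) := mul_le_mul hωE hh hh0 (by positivity)
    _ ≤ (Real.exp (8 / 7) * Real.exp (-u)) * ((50 / 49) ^ 2 * u ^ 4) := mul_le_mul_of_nonneg_right hEinv (by positivity)
    _ = (50 / 49) ^ 2 * Real.exp (8 / 7) * (u ^ 4 * Real.exp (-u)) := by ring
    _ ≤ (50 / 49) ^ 2 * Real.exp (8 / 7) * (4096 * Real.exp (-8)) := mul_le_mul_of_nonneg_left hdec (by positivity)
    _ = (50 / 49) ^ 2 * 4096 * (Real.exp (8 / 7) * Real.exp (-8)) := by ring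
    _ ≤ 5 := by nlinarith [hexp, Real.exp_pos (8 / 7), Real.exp_pos (-8)]

/-! ## §4 Reflection `x ↦ 1 − x` -/

/-- The logistic expression is ODD under `x ↦ 1 − x`: `σ″(1 − x) = −σ″(x)` on `(0,1)`. -/
theorem klsh_deriv2_one_sub {x : ℝ} (h0 : 0 < x) (h1 : x < 1) :
    deriv (deriv Real.smoothTransition) (1 - x) = -deriv (deriv Real.smoothTransition) x := by
  rw [kltd_deriv2_eq h0 h1, kltd_deriv2_eq (by linarith) (by linarith)]
  have e1 : (1 - (1 - x)) = x := by ring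
  rw [e1]
  have hE : Real.exp ((1 - x)⁻¹ - x⁻¹) = (Real.exp (x⁻¹ - (1 - x)⁻¹))⁻¹ := by
    rw [← Real.exp_neg]; ring_nf
  rw [hE]
  set E := Real.exp (x⁻¹ - (1 - x)⁻¹)
  have hEpos : 0 < E := Real.exp_pos _
  have h1' : (1 + E) ≠ 0 := by positivity
  have h2' : (1 + E⁻¹) ≠ 0 := by positivity
  have h3' : E ≠ 0 := hEpos.ne'
  field_simp
  ring

end Summit.HubbardSuperconductivity.HubbardSuperconductivity.Theorems.KLRegimeSplit

end
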